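import Summits.ResolutionOfSingularities.ResolutionOfSingularities.Theorems.JetCutTame
import HarnessLib

/-!
# JetCutLadder — decomp-res node «JetCut» (lens-2 g15 rev 5)

Content VERBATIM from the decomp-res lens-2 file `HOME/decomp-res-lens-2/g15/JetCut.lean` rev 5 (pin 9f53e5ca =
`parts/JetCut-rev5-9f53e5ca.lean`, 7 495 l;
HOME = run/shared/lean/pub/decomp-res; CRITIC-LEDGER rows 109 / 115 / 120 / 121 / 122 / 127 / 133 CLEARED; landing
order INBOX :231; the critic's
HYGIENE-landing.md h1–h11 applied — DOCSTRING-ONLY).  The lens's blocks RESTATED VERBATIM from lens-2 g12 / g13 /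
g14 (§R / §R13 / §R14) are DELETED:
they are the tree's `RelativeDeltaCut*` / `CurveLeafExit*` / `PinchCut*` modules (namespaces `RelativeDeltaCut`,
`CurveLeafExit`, `PinchCut`, opened;
the lens's `CurveLeafExitRestated.x` / `PinchCutRestated.x` are cited as `CurveLeafExit.x` / `PinchCut.x`, the three
pointwise engine edges of g12 as
`RelativeDeltaCut.x`).  Namespace `…Theorems.JetCut` (the lens's `Theses.JetCut` is gate-reserved), sub-namespaces
`Tame` / `Wide` / `Broad` / `Vast`
as in the lens; file split only (tree files ≤ 400 lines): sections, variables and every declaration exactly as in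
the lens, the long rev-0/1 prose
lives in HOME/decomp-res-lens-2/g15/NODE-g15.md §ARCHIVE-A (not in the tree).  Node files, in import order:
`JetCutJetKernels`, `JetCutPoint`, `JetCutClasses`, `JetCutKernels`, `JetCutTame`, `JetCutTameClasses`,
`JetCutTameKernels`, `JetCutLadder`, `JetCutWideClasses`, `JetCutWideKernels`, `JetCutMixed`, `JetCutBroadClasses`,
`JetCutBroadKernels`, `JetCutDegenerate`, `JetCutVastClasses`, `JetCutVastKernels`
(each possibly continued `…2`, `…3`), then the wiring `MaxContactCutJetCut*` (in the Theses cone).  All `--supports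
stmt-ResolutionOfSingularities-29273`
(`MaxContactCut.RungOne`); nothing closes 29273 — decided cells carry their engines as hypotheses, and exactly ONE
located-residual aside is booked on
the route for this column (`Vast.VastSpecialRung`, home `JetCutVastClasses`).

§L (rev 3): the ONE-PARAMETER LADDER (L) — a DEPTH LAW «⌊k/n⌋ blow-ups and exit» for deep principal tails in one
fibre variable: the weight calculus `WtIdeal` and the ladder kernels (`ladder_chart_identity`,
`ladder_monomial_identity`, `ladder_weight_step`, `ladder_sidechart_identity`, `ladder_depth` — PROVED), the ladder
ring shape, §L2 point level: ladder points `IsLadderAt`, uniformly ladder-shaped curves, ENGINE (L) `LadderExit`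
(HYGIENE h4/h5 in the law's docstring), the WIDE leaf (W) = (T) ∪ (L) with `WideExit`, the wide-special class and
the pointwise kernels.

(Sources: HunekeSwanson2006 Cor. 5.5.5; CossartJannsenSaito2020 Ch. 2, Thm. 3.6/3.7, Ch. 8; CossartPiltant2008 Prop.
4.2; CossartPiltant2019 Rem. 3.2; Hironaka1964 Ch. III; Hironaka1967; Hironaka1977; Moh1987; Giraud1975.)
-/

open CategoryTheory AlgebraicGeometry TopologicalSpace IsLocalRing
open Literature.AlgebraicGeometry.Resolution
open Summit.ResolutionOfSingularities.ResolutionOfSingularities.Theorems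
open Summit.ResolutionOfSingularities.ResolutionOfSingularities.Theorems.WeakOrderReduction
open Summit.ResolutionOfSingularities.ResolutionOfSingularities.Theorems.DeltaFaceCutClasses
open Summit.ResolutionOfSingularities.ResolutionOfSingularities.Theorems.RelativeDeltaCut
open Summit.ResolutionOfSingularities.ResolutionOfSingularities.Theorems.CurveLeafExit
open Summit.ResolutionOfSingularities.ResolutionOfSingularities.Theorems.PinchCut

namespace Summit.ResolutionOfSingularities.ResolutionOfSingularities.Theorems.JetCut

section LadderKernel

/-! ## §L  NEW (g15, rev 3): the ONE-PARAMETER LADDER (L) — a DEPTH LAW «⌊k/n⌋ blow-ups and exit» for deep tails in ONE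
transversal parameter (critic row 115 window (a)), and the WIDE cut (W) = tame ∪ ladder.

THE CLASS (at a closed point `y'` of the top curve `C`, germ dimension 4, `I` PRINCIPAL at `y'`): a regular system of
parameters `(z, U, W; v)` with `C = V(z, U, W)` and a generator `f` of `I_{y'}` of LADDER SHAPE
`f = zⁿ + β·Uⁿ + ε·W^k + h`, `ε` a unit, `n ≤ k`, `n ∤ k`, `h` in the WEIGHT IDEAL `Wt(nk+1)` spanned by the monomials
`z^a U^b W^e` with `(a+b)k + e·n ≥ nk + 1` (coefficients arbitrary), and the CONE COEFFICIENT `β` either a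
transversal regular parameter (`(z, U, W, β) = 𝔪_{y'}`: the core point, e.g. `β = v`) or a unit with the SIDE
condition `1 + βTⁿ ∉ 𝔔² + (z, U, W)` at every closed point `𝔔` of the fibre line `𝔪_{y'}R[T]` (order `≤ 1` of the
side-chart transform; automatic in the parameter case).  Bed: `deeptail:2` = `z² + v(u₁+u₂)² + u₁⁷` with
`U = u₁ + u₂`, `W = u₁`, `β = v`, `ε = 1`, `h = 0`, `k = 7` at the origin, `β = v` a unit with side transform
`1 + (a + v′)(t + s)² ∋ v′t²` of order 1 at `v = a ≠ 0`; `deeptail:3` = `z³ + v(u₁+u₂)³ + u₁⁷`; every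
`zⁿ + v(u₁+u₂)ⁿ + u₁^k`, `n ∤ k` (census T-jet (B2): depth `⌊k/n⌋`).  NOT in the class: symmetric tails
`u₁⁵ + u₂⁵` (`= U⁵ + U⁴W + UW⁴` in characteristic 2 — no pure `W^k`; census: depth `k − 1`), branching cones
(rev 2's (T)), non-principal ideals.

THE LAW (paper; EXACT-ON-PAPER with the bookkeeping PROVED in kernel).  Blow up `C`; in the `W`-chart
`f₁ = f(WX₀, WX₁, W)/Wⁿ = X₀ⁿ + βX₁ⁿ + εW^{k−n} + h₁` with `h₁ ∈ Wt₁(n(k−n)+1)` — `ladder_chart_identity`,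
`ladder_monomial_identity` and the weight step `ladder_weight_step` ((a+b)k + en ≥ nk+1 ∧ n ≤ k ⟹ a+b+e ≥ n+1 and
the transformed monomial has weight ≥ n(k−n)+1 for the new exponent) are KERNEL; so the SHAPE REPRODUCES with
`k ↦ k − n` and the same `β`, `ε`.  Near points of `f₁` over `C`: in the `W`-chart only the origin of the fibre over
each point of `C` (over the core point the term `βX₁ⁿ` has the LINEAR part `tⁿ·β` at `(0, t ≠ 0)` since `β` is a
parameter; at `X₀ = c ≠ 0` over the core point the value is `cⁿ ≠ 0`; over `v = a` with `β` a unit the W-chart value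
`c₀ⁿ + β̄c₁ⁿ` CAN vanish at finitely many fibre points — there the order is `≤ 1` by `SideClean` read in the `z`-chart
(the same points), so no near point arises — HYGIENE h4), in the `z`- and
`U`-charts order `≤ 1` (`ladder_sidechart_identity`: `1 + βU′ⁿ + X₀·(…)` — a unit over the core point, order `≤ 1`
over `v = a` by the SIDE condition; `X₀′ⁿ + β + X₁·(…)` has the linear part `dβ` over the core point and is the
same side condition over `v = a`) — no monomial of `h` has `a + b + e ≤ n`, so `h`'s transforms lie in the
exceptional ideal and never touch these leading terms.  Hence the near locus over `C` is the SECTION CURVE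
`C₁ = {X₀ = X₁ = W = 0} ≅ C` (= the order-`n` locus `N₁` of the controlled transform over `C`, an intrinsic closed
subscheme — which is why the
local W-chart origins over the points of `C` glue to ONE regular curve `C₁ ≅ C`; HYGIENE h5) iff `k − n ≥ n`, the
transform is again PRINCIPAL of ladder shape `(n, k − n)` along
`C₁`, and the ladder repeats: after `⌊k/n⌋` blow-ups of section curves (all regular, all inside the top locus of the
principal transform, all over `C`: a weakly admissible package over `S = C`) the exponent is `r = k mod n ∈ [1, n−1]`
(`ladder_depth`, KERNEL) and `f_m ≡ εW^r (mod 𝔪^{r+1})` at the only candidate point (every monomial of `h_m` has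
degree `≥ r + 1` by the weight inequality), order `≤ 1` or unit elsewhere: ORDER `< n` AT EVERY POINT OVER `C`
(non-closed points by semicontinuity of order, as for (J)).  So ENGINE (L) `LadderExit` holds on paper for every
regular `Y`, every residue field, every characteristic: DECIDED-MOD-PORT (port L + HS 5.5.5 regularity of the
chart rings, as for (J)/(T)).  Ladder points are NOT tame (their near points have `τ = 1`): (L) is a second,
MULTI-STEP direction out of the located cell; the WIDE leaf (W) = (T) ∪ (L) and the residual `WideSpecialRung` =
pinch-special ∧ ¬ tame-curve ∧ ¬ ladder-curve ⊆ `TameSpecialRung` (EXACT refinement given the wide decided half).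
[cite: Hironaka1964 Ch. III; CossartJannsenSaito2020 Ch. 2, Ch. 8; CossartPiltant2008 Prop. 4.2; folklore
(quasi-homogeneous blow-up bookkeeping)] -/

/-- **WEIGHT STEP** [rev 3; KERNEL (PROVED)]: a monomial `z^a U^b W^e` of weight `(a+b)k + e·n ≥ nk + 1` with
`n ≤ k` has total degree `≥ n + 1`, and its `W`-chart transform `X₀^a X₁^b W^(a+b+e−n)` has weight
`≥ n(k − n) + 1` for the new exponent `k − n`: the weight ideal REPRODUCES along the ladder. [folklore] -/
theorem ladder_weight_step {n k a b e : ℕ} (hnk : n ≤ k)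
    (hw : n * k + 1 ≤ (a + b) * k + e * n) :
    n + 1 ≤ a + b + e ∧ n * (k - n) + 1 ≤ (a + b) * (k - n) + (a + b + e - n) * n := by
  obtain ⟨d, rfl⟩ := Nat.exists_eq_add_of_le hnk
  have h1 : n + 1 ≤ a + b + e := by
    by_contra hlt
    have hle : a + b + e ≤ n := by omega
    have : (a + b) * (n + d) + e * n ≤ n * (n + d) := by nlinarith
    omega
  refine ⟨h1, ?_⟩
  obtain ⟨m, hm⟩ := Nat.exists_eq_add_of_le (show n ≤ a + b + e by omega)
  have hsub : n + d - n = d := by omega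
  have hsub2 : a + b + e - n = m := by omega
  rw [hsub, hsub2]
  nlinarith [hm]

/-- **DEPTH** [rev 3; KERNEL (PROVED)]: for `n ∤ k` the stage exponents `k − i·n` stay `≥ n` for `i < ⌊k/n⌋`, and
after `⌊k/n⌋` steps the exponent is `k mod n ∈ [1, n − 1]`. [folklore] -/
theorem ladder_depth {n k : ℕ} (hn : 1 ≤ n) (hndvd : ¬ n ∣ k) :
    (∀ i, i < k / n → n ≤ k - i * n) ∧ 0 < k % n ∧ k % n < n ∧ k - (k / n) * n = k % n := by
  refine ⟨?_, ?_, Nat.mod_lt _ (by omega), ?_⟩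
  · intro i hi
    have h1 : (i + 1) * n ≤ k := by
      have := Nat.div_mul_le_self k n
      have h2 : (i + 1) * n ≤ (k / n) * n := Nat.mul_le_mul_right _ hi
      omega
    have : (i + 1) * n = i * n + n := by ring
    omega
  · exact Nat.pos_of_ne_zero (fun h0 => hndvd (Nat.dvd_of_mod_eq_zero h0))
  · have := Nat.div_add_mod' k n
    omega

/-- **`W`-CHART IDENTITY** for the model trinomial [rev 3; KERNEL (PROVED), any commutative ring]: substituting
`z = W·X₀`, `U = W·X₁` factors `Wⁿ` off `zⁿ + βUⁿ + εW^k`, leaving the SAME shape with exponent `k − n`. [folklore] -/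
theorem ladder_chart_identity {R : Type} [CommRing R] (β ε W X₀ X₁ : R) {n k : ℕ} (hnk : n ≤ k) :
    (W * X₀) ^ n + β * (W * X₁) ^ n + ε * W ^ k = W ^ n * (X₀ ^ n + β * X₁ ^ n + ε * W ^ (k - n)) := by
  obtain ⟨d, rfl⟩ := Nat.exists_eq_add_of_le hnk
  rw [Nat.add_sub_cancel_left, pow_add, mul_pow, mul_pow]
  ring

/-- **`W`-CHART IDENTITY for a tail monomial** [rev 3; KERNEL (PROVED)]: `z^a U^b W^e ↦ Wⁿ·(X₀^a X₁^b W^(a+b+e−n))`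
when `n ≤ a + b + e`. [folklore] -/
theorem ladder_monomial_identity {R : Type} [CommRing R] (W X₀ X₁ : R) {n a b e : ℕ} (h : n ≤ a + b + e) :
    (W * X₀) ^ a * (W * X₁) ^ b * W ^ e = W ^ n * (X₀ ^ a * X₁ ^ b * W ^ (a + b + e - n)) := by
  obtain ⟨m, hm⟩ := Nat.exists_eq_add_of_le h
  have : a + b + e - n = m := by omega
  rw [this, mul_pow, mul_pow]
  have key : W ^ a * W ^ b * W ^ e = W ^ n * W ^ m := by
    rw [← pow_add, ← pow_add, ← pow_add, hm]
  calc W ^ a * X₀ ^ a * (W ^ b * X₁ ^ b) * W ^ e = (W ^ a * W ^ b * W ^ e) * (X₀ ^ a * X₁ ^ b) := by ring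
    _ = W ^ n * W ^ m * (X₀ ^ a * X₁ ^ b) := by rw [key]
    _ = W ^ n * (X₀ ^ a * X₁ ^ b * W ^ m) := by ring

/-- **SIDE-CHART IDENTITY** [rev 3; KERNEL (PROVED)]: substituting `U = z·U′`, `W = z·W′` factors `zⁿ` off the
trinomial leaving `1 + βU′ⁿ + ε z^(k−n) W′^k` (the `z`-chart; the `U`-chart is symmetric). [folklore] -/
theorem ladder_sidechart_identity {R : Type} [CommRing R] (β ε X₀ U' W' : R) {n k : ℕ} (hnk : n ≤ k) :
    X₀ ^ n + β * (X₀ * U') ^ n + ε * (X₀ * W') ^ k = X₀ ^ n * (1 + β * U' ^ n + ε * (X₀ ^ (k - n) * W' ^ k)) := by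
  obtain ⟨d, rfl⟩ := Nat.exists_eq_add_of_le hnk
  rw [Nat.add_sub_cancel_left, mul_pow, mul_pow, pow_add]
  ring

example : 7 / 2 = 3 ∧ 7 % 2 = 1 ∧ ¬ 2 ∣ 7 := by decide   -- deeptail:2 (n = 2, k = 7): depth 3, last exponent 1

example : 7 / 3 = 2 ∧ 7 % 3 = 1 ∧ ¬ 3 ∣ 7 := by decide   -- deeptail:3 (n = 3, k = 7): depth 2, last exponent 1

end LadderKernel

section LadderRing

variable {R : Type} [CommRing R]

/-- **WEIGHT IDEAL** `Wt c n k N` [rev 3]: the ideal spanned by the monomials `c 0 ^ a * c 1 ^ b * c 2 ^ e` with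
`(a + b)·k + e·n ≥ N` (`c = (z, U, W)`; weights `k, k, n`).  DEFINITION (NEW object). [folklore] -/
def WtIdeal (c : Fin 3 → R) (n k N : ℕ) : Ideal R :=
  Ideal.span {x : R | ∃ a b e : ℕ, N ≤ (a + b) * k + e * n ∧ x = c 0 ^ a * c 1 ^ b * c 2 ^ e}

/-- **SIDE CONDITION** `SideClean M c β n` [rev 3]: at every closed point `𝔔` of the fibre line `M·R[T]`, the side-chart
leading term `1 + βTⁿ` has order `≤ 1` modulo the curve parameters: `1 + βTⁿ ∉ 𝔔² + (c)R[T]`.  Automatic when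
`β ∈ M` (then `1 + βTⁿ ≡ 1`), a genuine condition when `β` is a unit (no side near point; `deeptail`: `β = v`,
witness `v′t²`).  DEFINITION (NEW class predicate). -/
def SideClean (M : Ideal R) (c : Fin 3 → R) (β : R) (n : ℕ) : Prop :=
  ∀ Q : Ideal (Polynomial R), Q.IsMaximal → Ideal.map (Polynomial.C : R →+* Polynomial R) M ≤ Q →
    (1 + Polynomial.C β * Polynomial.X ^ n : Polynomial R) ∉
      Q ^ 2 ⊔ Ideal.map (Polynomial.C : R →+* Polynomial R) (Ideal.span (Set.range c))

/-- **LADDER SHAPE** `LadderShape M c β ε h f n k` [rev 3; the one-step-reproducing presentation]: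
`f = c 0 ^ n + β * c 1 ^ n + ε * c 2 ^ k + h`, `ε` a unit, `h ∈ Wt c n k (n*k+1)`, `n ≤ k`, `n ∤ k`, the cone
coefficient `β` a transversal parameter (`span (c, β) = M`) or a unit, and the side condition.  EXACT-ON-PAPER
consequence (§L docstring): principal `I = (f)` of ladder shape uniformly along the regular top curve `V(c)` exits
after `⌊k/n⌋` blow-ups of section curves.  DEFINITION (NEW class predicate). [folklore; CossartJannsenSaito2020 Ch. 2] -/
def LadderShape (M : Ideal R) (c : Fin 3 → R) (β ε h f : R) (n k : ℕ) : Prop :=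
  f = c 0 ^ n + β * c 1 ^ n + ε * c 2 ^ k + h ∧ IsUnit ε ∧ h ∈ WtIdeal c n k (n * k + 1) ∧ n ≤ k ∧ ¬ n ∣ k ∧
    (Ideal.span (Set.range c ∪ {β}) = M ∨ IsUnit β) ∧ SideClean M c β n

/-- The model trinomial itself (`h = 0`) has ladder shape whenever the side data are right.  KERNEL (PROVED). [folklore] -/
theorem ladderShape_trinomial (M : Ideal R) (c : Fin 3 → R) (β ε : R) (n k : ℕ) (hε : IsUnit ε) (hnk : n ≤ k)
    (hndvd : ¬ n ∣ k) (hβ : Ideal.span (Set.range c ∪ {β}) = M ∨ IsUnit β) (hside : SideClean M c β n) :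
    LadderShape M c β ε 0 (c 0 ^ n + β * c 1 ^ n + ε * c 2 ^ k) n k :=
  ⟨by rw [add_zero], hε, Ideal.zero_mem _, hnk, hndvd, hβ, hside⟩

end LadderRing

/-! ### §L2  point level — ladder points, uniformly ladder-shaped curves, ENGINE (L), the WIDE leaf and its residual -/

/-- **LADDER-SHAPED at `y` transversal to `η` with exponents `(n, k)`** [rev 3] (`IsLadderAt I n k η y`): germ
dimension 4, regular parameters `c = (z, U, W)` generating the curve prime, `(c, v) = 𝔪_y`, `I_y = (f)` PRINCIPAL,
`f` of ladder shape.  DEFINITION (NEW class predicate). (Sources: CossartJannsenSaito2020 Ch. 2; folklore.) -/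
def IsLadderAt {Y : Scheme.{0}} (I : Y.IdealSheafData) (n k : ℕ) (η y : Y) : Prop :=
  ∃ h : η ⤳ y, ∃ (c : Fin 3 → Y.presheaf.stalk y) (v β ε r f : Y.presheaf.stalk y),
    Ideal.span (Set.range c) = curvePrime h ∧
      Ideal.span (Set.range c ∪ {v}) = maximalIdeal (Y.presheaf.stalk y) ∧
      (maximalIdeal (Y.presheaf.stalk y)).spanFinrank = 4 ∧
      stalkIdeal I y = Ideal.span {f} ∧
      LadderShape (maximalIdeal (Y.presheaf.stalk y)) c β ε r f n k

/-- **UNIFORMLY LADDER-SHAPED CURVE** [rev 3] (`IsUniformLadderCurve I n k η`): `η` is a curve point and EVERY closed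
point of `closure {η}` is ladder-shaped transversal to `η` with the SAME exponents `(n, k)`.  The hypothesis of
ENGINE (L).  DEFINITION (NEW class predicate). -/
def IsUniformLadderCurve {Y : Scheme.{0}} (I : Y.IdealSheafData) (n k : ℕ) (η : Y) : Prop :=
  IsCurvePt η ∧ ∀ y : Y, η ⤳ y → IsClosed ({y} : Set Y) → IsLadderAt I n k η y

/-- **ENGINE (L) `LadderExit`** [rev 3; DECIDED · paper proof = the ladder of the §L docstring: `⌊k/n⌋` blow-ups of
section curves, shape reproduction by `ladder_chart_identity` / `ladder_monomial_identity` / `ladder_weight_step`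
(KERNEL), termination by `ladder_depth` (KERNEL), exits by the weight inequality, side charts by the side
condition; ingredients of the port: HS 5.5.5 regularity of the chart rings, permissibility of regular centres in
the top locus of a principal marked ideal, semicontinuity of order · every regular scheme, residue field,
characteristic]: a uniformly ladder-shaped curve of order `n ≥ 2` has an exit package with centres over it.
STATEMENT (engine). (Sources: Hironaka1964; CossartJannsenSaito2020 Ch. 2, Ch. 8; CossartPiltant2008 Prop. 4.2.) -/
def LadderExit : Prop :=
  ∀ (Y : Scheme.{0}), Scheme.IsRegular Y → ∀ (I : Y.IdealSheafData) (n : ℕ), 2 ≤ n → ∀ (k : ℕ) (η : Y),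
    IsUniformLadderCurve I n k η → PackageExitsOver I n {y : Y | η ⤳ y}

/-- **LADDER-CURVE point** [rev 3] (NEW DECIDED CLASS, leaf (L)): `y` lies on (or is the generic point of) a
Top-isolated, uniformly ladder-shaped curve.  DEFINITION (NEW class). -/
def IsLadderCurvePt {Y : Scheme.{0}} (I : Y.IdealSheafData) (n : ℕ) (y : Y) : Prop :=
  ∃ (η : Y) (k : ℕ), η ⤳ y ∧ IsTopIsolatedClosure I n η ∧ IsUniformLadderCurve I n k η

/-- **WIDE-CURVE point** [rev 3] (leaf (W) = (T) ∪ (L)): jet-tame-curve OR ladder-curve.  DEFINITION (NEW class). -/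
def IsWideCurvePt {Y : Scheme.{0}} (I : Y.IdealSheafData) (n : ℕ) (y : Y) : Prop :=
  IsJetTameCurvePt I n y ∨ IsLadderCurvePt I n y

/-- **ENGINE (W)** = both engines (T) and (L).  STATEMENT (conjunction of engines). -/
def WideExit : Prop :=
  JetTameExit ∧ LadderExit

/-- **WIDE-SPECIAL core point** [rev 3] (THE RE-LOCATED CLASS): pinch-special and neither jet-tame-curve nor
ladder-curve — on every admissible curve through `y` a near point with `τ = 1` survives AND the germ is not a
principal one-parameter ladder along it (bed: symmetric tails `u₁⁵ + u₂⁵` under a `v(u₁+u₂)²` cone, binary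
towers with two tail parameters; NOT `deeptail:2/3`, NOT `branch:2`).  DEFINITION (NEW class). [folklore] -/
def IsWideSpecialPt {k : Type} [Field k] {Y : Scheme.{0}} (g : Y ⟶ Spec (.of k)) (hY : Scheme.IsRegular Y)
    (I : Y.IdealSheafData) (n : ℕ) (y : Y) : Prop :=
  IsPinchSpecialPt g hY I n y ∧ ¬ IsWideCurvePt I n y

/-- (T) ⊆ (W).  KERNEL (PROVED). [folklore] -/
theorem isWideCurvePt_of_isJetTameCurvePt {Y : Scheme.{0}} {I : Y.IdealSheafData} {n : ℕ} {y : Y} :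
    IsJetTameCurvePt I n y → IsWideCurvePt I n y :=
  Or.inl

/-- (L) ⊆ (W).  KERNEL (PROVED). [folklore] -/
theorem isWideCurvePt_of_isLadderCurvePt {Y : Scheme.{0}} {I : Y.IdealSheafData} {n : ℕ} {y : Y} :
    IsLadderCurvePt I n y → IsWideCurvePt I n y :=
  Or.inr

/-- (J) ⊆ (W).  KERNEL (PROVED). [folklore] -/
theorem isWideCurvePt_of_isJetCurvePt {Y : Scheme.{0}} {I : Y.IdealSheafData} {n : ℕ} {y : Y} :
    IsJetCurvePt I n y → IsWideCurvePt I n y :=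
  fun h => Or.inl (isJetTameCurvePt_of_isJetCurvePt h)

/-- (CT) ⊆ (W), marking `n ≥ 2`.  KERNEL (PROVED). [folklore] -/
theorem isWideCurvePt_of_isConeTailCurvePt {Y : Scheme.{0}} {I : Y.IdealSheafData} {n : ℕ} (hn : 2 ≤ n) {y : Y} :
    IsConeTailCurvePt I n y → IsWideCurvePt I n y :=
  fun h => Or.inl (isJetTameCurvePt_of_isConeTailCurvePt hn h)

/-- ENGINE (W) gives ENGINE (T), (J), (C).  KERNEL (PROVED). [folklore] -/
theorem jetTameExit_of_wideExit (hW : WideExit) : JetTameExit :=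
  hW.1

/-- `ladderExit_of_wideExit`: Auxiliary step of this node's calculus, VERBATIM from the lens file (see the module
docstring); the statement is its type. [folklore] -/
theorem ladderExit_of_wideExit (hW : WideExit) : LadderExit :=
  hW.2

/-- `jetExit_of_wideExit`: Auxiliary step of this node's calculus, VERBATIM from the lens file (see the module
docstring); the statement is its type. [folklore] -/
theorem jetExit_of_wideExit (hW : WideExit) : JetExit :=
  jetExit_of_jetTameExit hW.1

/-- `flatConeExit_of_wideExit`: Auxiliary step of this node's calculus, VERBATIM from the lens file (see the module
docstring); the statement is its type. [folklore] -/
theorem flatConeExit_of_wideExit (hW : WideExit) : FlatConeExit :=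
  flatConeExit_of_jetTameExit hW.1

/-- Under ENGINE (L), every ladder-curve point is a curve-exit point (the port's hypothesis shape).  KERNEL
(PROVED). [folklore] -/
theorem isCurveExitPt_of_isLadderCurvePt {Y : Scheme.{0}} {I : Y.IdealSheafData} {n : ℕ} {y : Y}
    (hL : LadderExit) (hY : Scheme.IsRegular Y) (hn : 2 ≤ n) (h : IsLadderCurvePt I n y) :
    IsCurveExitPt I n y := by
  obtain ⟨η, k, hηy, hiso, hcurve⟩ := h
  exact ⟨η, hηy, hcurve.1, hiso, hL Y hY I n hn k η hcurve⟩

/-- Under ENGINE (W), every wide-curve point is a curve-exit point.  KERNEL (PROVED). [folklore] -/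
theorem isCurveExitPt_of_isWideCurvePt {Y : Scheme.{0}} {I : Y.IdealSheafData} {n : ℕ} {y : Y}
    (hW : WideExit) (hY : Scheme.IsRegular Y) (hn : 2 ≤ n) (h : IsWideCurvePt I n y) :
    IsCurveExitPt I n y := by
  rcases h with h | h
  · exact isCurveExitPt_of_isJetTameCurvePt hW.1 hY hn h
  · exact isCurveExitPt_of_isLadderCurvePt hW.2 hY hn h

/-- Wide-special ⇒ tame-special ⇒ jet-special ⇒ pinch-special (the located class keeps shrinking).  KERNEL (PROVED).
[folklore] -/
theorem isTameSpecialPt_of_isWideSpecialPt {k : Type} [Field k] {Y : Scheme.{0}} {g : Y ⟶ Spec (.of k)}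
    {hY : Scheme.IsRegular Y} {I : Y.IdealSheafData} {n : ℕ} {y : Y} (h : IsWideSpecialPt g hY I n y) :
    IsTameSpecialPt g hY I n y :=
  ⟨h.1, fun hT => h.2 (Or.inl hT)⟩

/-- A wide-curve point is never wide-special.  KERNEL (PROVED). [folklore] -/
theorem not_isWideSpecialPt_of_isWideCurvePt {k : Type} [Field k] {Y : Scheme.{0}} {g : Y ⟶ Spec (.of k)}
    {hY : Scheme.IsRegular Y} {I : Y.IdealSheafData} {n : ℕ} {y : Y} (h : IsWideCurvePt I n y) :
    ¬ IsWideSpecialPt g hY I n y :=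
  fun hs => hs.2 h

namespace Wide

/-! ### §L4 + §LK  sequence level and kernels: the WIDE cut, in the sub-namespace `Wide` — a MECHANICAL COPY of §J4 and §K
with the jet leaf (J) replaced by the wide leaf (W) (`IsJetCurvePt ↦ IsWideCurvePt`, `IsJetSpecialPt ↦ IsWideSpecialPt`,
`JetExit ↦ WideExit`, names `SeqJ… ↦ SeqW…`, `Jet…Rung ↦ Wide…Rung`). -/

/-! ### §L4  The graded statements of the WIDE cut (mechanical copy of §J4 with the jet leaf (J) replaced by the
wide leaf (W) = tame ∪ ladder) -/

/-- **`SeqWGen n`** — weak order reduction in dimension four at marking `n` for data ALL of whose top points are of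
class ≥ 2, near-generic (g10), δ-generic (g11), curve-generic (g12), rel-curve-generic or flat-curve (g13), pinch-curve
or cone-curve (g14), or WIDE-CURVE points (g15 rev 3: jet-tame-curve ∨ ladder-curve).  [DECIDED-MOD-PORT relative to
`SeqDimFour 2 n`:
`wGenRungAt_of_engines`.]  STATEMENT SCHEMA. (Sources: BierstoneGrigorievMilmanWlodarczyk2011 §3.1; CossartPiltant2008
Prop. 4.2; Hironaka1967.) -/
def SeqWGen (n : ℕ) : Prop :=
  ∀ p : ℕ, p.Prime → ∀ (k : Type) [Field k] [CharP k p]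
    (Y : Scheme.{0}) (g : Y ⟶ Spec (.of k)), IsSeparated g → LocallyOfFiniteType g → QuasiCompact g →
    ∀ hY : Scheme.IsRegular Y, topologicalKrullDim Y ≤ 4 →
    ∀ I : Y.IdealSheafData, (∀ y : Y, idealOrder I y ≤ ((n : ℕ) : ℕ∞)) →
      (∀ y : Y, idealOrder I y = ((n : ℕ) : ℕ∞) →
        ClassGE g hY I n 2 y ∨ VeryNearCutClasses.IsNearGenericPt I n y ∨ IsDeltaGenericPt I n y ∨
          IsCurveGenericPt I n y ∨ IsRelCurveGenericPt I n y ∨ IsFlatCurvePt I n y ∨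
          IsPinchCurvePt I n y ∨ IsConeCurvePt I n y ∨ IsWideCurvePt I n y) →
      ∃ t : CentreSeq Y, WeakResolution t (⟨I, [], n⟩ : MarkedIdeal Y)

end Wide

end Summit.ResolutionOfSingularities.ResolutionOfSingularities.Theorems.JetCut
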